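import Summits.QuantumFields.YangMills.Theorems.BalabanUVNodesN18KernelLettersJunctions
import Summits.QuantumFields.YangMills.Theorems.BalabanUVNodesN18StepMatchedLetterFiniteVolume

/-!
# BalabanUVNodes ∕ N18 — THE KEYINGS OF NODE N18's LETTER COINCIDE MODULO NODE N22: NE5 at SOME member of run B's first-coupling family per point (a selector — the N19′
# edge's `h18` shape —, the (0.20)-STEP-MATCHED member — g7's R-N18-SEL —, or any member) + the UV-FADING OF THE FIRST-ENTRY HISTORY MODULUS (`Λ_{n,0} ≤ C₉ω^n`, carried by node
# N22's letter of record: `ℓ.moduli k i = ℓ.C₉·ℓ.ω^(k−i)`) ⟹ THE BOX LETTER at EVERY member `b ∈ ]0,γ]` with `C₅ ↦ C₅ + C₉γ`; generic carriers, def-W1's kernels, the record, the pin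
# (Track A, DAG node N18 = NE5; key K3⁸ `SpineGivenEndpointR13SepCoPHV` = stmt-QuantumFields-27366, skeleton v6 b4e55110ab73e679; width seat `pub-ymgap-dag-n18-w1` g8 — successor of
# g2's `ne5_family_of_member` ∕ (J1) `kernelStepRate_of_member_of_windowedNE9` (ONE CONSTANT member) and of g6∕g7's keying analysis (`…N18RunWindowEdge`, `…N18StepMatchedLetter*`))

HONEST FRAMING.  Count-neutral kernel bookkeeping BY NAME (`--kind proof --supports stmt-QuantumFields-27366 --as helper`): ONE triangle inequality through the member chosen
per point plus g2's spread bound `|EB b g U X − EB b′ g U X| ≤ C₉ω^{scale X}|b − b′|e^{−κ d X}`, re-proved here under the WEAKER first-entry fading (only the modulus of the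
OLDEST coupling is read).  Every letter — NE9 with its moduli (node N22's row `h9`), the fading of the first-entry modulus, the selector-keyed ∕ step-matched ∕ pointwise NE5
(node N18's content in any keying), (1.21) existence, predecessor existence ∕ the level-0 β-side binders — is a DISPLAYED HYPOTHESIS, asserted ∕ inhabited nowhere new (A6:
jointly inhabited by dag-n18-w2's fading two-bond family p613743, whose box letter gives the step-matched one by g7's `kernelStepMatched_of_kernelStepRate` and comes back
here; LOCATED — the content is Bałaban's η-rate NE5 and the history-Lipschitz rate NE9, NOT PRINTED for d = 4); nothing of Bałaban's is asserted, inhabited, discharged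
or refuted; N18 ∕ N22 ∕ (D4) NOT discharged; K3⁸ OPEN (v6), no stub proved ∕ refuted, NO skeleton re-keyed or re-keying asked; K3⁷ 20544 aside.  Counts UNMOVED (typed
28∕28 · discharged 5∕27, A 5∕28).  One finite four-torus programme at fixed `ε`, Bałaban AS PRINTED; route R4 closes ONLY the conditional finite-𝕋⁴ rung `BalabanLadder.UV`
— NOT the continuum limit, NOT ℝ⁴, NOT OS, NOT the Yang–Mills mass gap, NOT Clay.  THEOREMS ONLY: 0 `def`, 0 `instance`, 0 `sorry`, standard axioms.

WHY.  g6 (evidence #40) located that modulo the ym-nodeO F-E finding the BOX conjunct `N18At` is presumptively dead at the record and proposed the run-window keying R-N18-RUN; g7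
(evidence #58) refined it to the step-matched keying R-N18-SEL and offered a letter text for a K3 v7.  But the keying question is NOT independent of the bill's row `h9`: node N22's
letter of record `WindowedNE9OfRecord₁₃ … ℓ.κ ℓ.moduli` (K3V5Defs :252; `RatesHolderAt`'s last conjunct is `N22At`) has moduli `ℓ.moduli k i = ℓ.C₉·ℓ.ω^(k−i)` (`Node00/RateRecord11`), so
it bounds the dependence of `Π_{k+2}(b, g; z)` on the prepended first coupling `b` by `ℓ.C₉·ℓ.ω^{k+1}|b − b′|e^{−ℓ.κ|z|₁}`; g2 used this to reduce the box family to ONE CONSTANT member,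
and the argument is POINTWISE, so it reduces the box family to ANY member chosen per point.  LOCATED CONSEQUENCES (for the K3 v7 precut ∕ n27 ∕ the N19′ lanes; nothing asked):
(α) `(∃ C₅, box) ⟺ (∃ C₅, step-matched)` mod NE9-with-fading + predecessor existence — re-keying stub 1's N18 conjunct BUYS NOTHING inside K3 (R-N18-SEL ∕ RUN matter only for a
consumer holding N18 WITHOUT N22 — none in K3); (β) the N19′ `h18` at ANY admissible selector gives the box and hence `h18` at any other selector; (γ) the F-E shadow kills `h9`
and `hS` JOINTLY (under first-entry-only kernels g6 FILE 1's box rigidity IS the `b`-face of NE9 with UV-fading), so NO keying of N18 rescues stub 1 at the present record — only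
the F-E repair does.

WHAT (theorems only; `kernelStepRate_of_selector_of_ne9` of the INTENT list is subsumed by `…_of_pointwise_of_ne9` ∕ `ne5_objects_family_of_selector`).  §1 generic two-carrier
setting of g2 §1: `firstEntryFading_of_fadingMemory` · `historySum_prepend_le_of_firstEntry` · `eb_sub_eb_le_of_ne9_prepend_firstEntry` · ★★ `ne5_family_of_pointwise` ·
★ `ne5_family_of_selector` · `ne5_selector_of_selector` · ★ `ne5_family_of_stepMatched`.  §2 def-W1's kernel objects, any `ℰ`: `ne5_objects_family_of_pointwise` ·
`ne5_objects_family_of_selector` · ★★ `kernelStepRate_of_pointwise_of_ne9` · ★★ `kernelStepRate_of_kernelStepMatched_of_ne9` · ★ `exists_kernelStepRate_iff_exists_kernelStepMatched` ·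
`pred_exists_on_window_of_levelZero` · ★ `kernelStepRate_of_kernelStepMatched_of_windowedNE9` · ★★ `kernelStepRate_of_windowedStepMatched_of_windowedNE9` (g7 FILE 4 §9's FINITE-VOLUME
step-matched row ⟹ the box LIMIT letter) · `n18At_u3OfRecord₁₃_objects_of_n22At_of_selector ∕ _of_stepMatched`.  §3 record ∕ pin: ★★ `kernelStepRateOfRecord₁₃_of_stepMatched_of_windowedNE9OfRecord₁₃`
· ★★ `kernelStepRateOfRecord₁₃_of_windowedStepMatchedOfRecord_of_windowedNE9OfRecord₁₃` · `n18At_u3OfRecord₁₃_objectsOfRecord₁₃_of_n22At_of_selector` ·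
★ `n18At_rateCarriers_of_kernels_pin_of_n22At_of_ne5_selector` (under the pin: `N22At` + the N19′ `h18` SHAPE at ANY admissible selector ⟹ `N18At (rateCarriersOfRecord₁₃CoPH 𝔯 …).u3`).

References (TYPES ∕ locators only): [Balaban1987RG1] CMP **109** (1987): (0.20) p. 256, Thm 1 p. 259, (1.18) p. 263, (1.20)–(1.22) p. 264, §5 p. 298; [Balaban1988RG2Cluster] CMP **116**
(1988): (2.13) p. 14, (2.14) p. 15 (the history-dependent terms the moduli weigh).
-/

noncomputable section

namespace YMDAG.N18.KeyingsModuloN22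

open scoped BigOperators
open Literature.MathematicalPhysics.QuantumFieldTheory.Balaban1983to89
open Literature.MathematicalPhysics.QuantumFieldTheory.Balaban1983to89.T4Continuum (T4Family ULoop)
open Literature.MathematicalPhysics.QuantumFieldTheory.Balaban1983to89.FlowStep (Box HBeta)
open Literature.MathematicalPhysics.QuantumFieldTheory.Balaban1983to89.T4OutputRate (Carriers Functional Window NE5 NE9 FadingMemory mem_window)
open Literature.MathematicalPhysics.QuantumFieldTheory.Balaban1983to89.T4TowerRateComposition (fadingMemory_const_nonneg)
open Literature.MathematicalPhysics.QuantumFieldTheory.Balaban1983to89.B12Sec2to5 (l1)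
open Literature.MathematicalPhysics.QuantumFieldTheory.Balaban1983to89.Node00 (TermFamily1 prependCoupling prependCoupling_zero prependCoupling_succ U3Letters₁₁ Stage13Params
  Stage13HParams)
open Literature.MathematicalPhysics.QuantumFieldTheory.Balaban1983to89.Node00.U3OfKernels (kernelA EA EB pt carriers objects objectsOfRecord₁₃ histPrefix ne5_iff ne9_EA_iff
  prependCoupling_mem_window)
open Literature.MathematicalPhysics.QuantumFieldTheory.Balaban1983to89.Node00.U3KernelLetters (KernelStepRate PolLimitsExist WindowedNE9 kernelStepRate_iff KernelStepRateOfRecord₁₃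
  PolLimitsExistOfRecord₁₃ WindowedNE9OfRecord₁₃)
open YMDAG.N22.AtKernels (ne9_EA_of_windowed)
open YMDAG.N18.AtU3OfKernels (EB_eq_EA_prepend_shift n18At_u3OfRecord₁₃_objects_iff_kernelStepRate)
open YMDAG.N18.StepMatchedLetter (kernelStepMatched_of_kernelStepRate kernelStepMatched_of_windowedStepMatched exists_pred_of_sign_upper_cont)
open YMDAG.UVSplit

/-! ## §1 Generic carriers: the family from SOME member per point, under NE9 with a fading FIRST-ENTRY modulus -/

section Generic

variable {C C' : Carriers} (EA : Functional C C.BgA) (EA' : Functional C' C'.BgA) (EB : ℝ → Functional C C.BgB) (sh : C.Dom → C'.Dom) (τ : C.BgB → C'.BgA)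
  {W W' : Set (ℕ → ℝ)} {γ κ C₉ ω θ C₅ : ℝ} {Λ : ℕ → ℕ → ℝ}
  (hsc : ∀ X, C.scale X ≤ C'.scale (sh X)) (hd : ∀ X, C'.d (sh X) = C.d X)
  (hlink : ∀ (b : ℝ) (g : ℕ → ℝ) (U : C.BgB) (X : C.Dom), EB b g U X = EA' (prependCoupling b g) (τ U) (sh X))
  (hW : ∀ b : ℝ, 0 < b → b ≤ γ → ∀ g ∈ W, prependCoupling b g ∈ W')
  (h9 : NE9 EA' W' κ Λ) (hC₉ : 0 ≤ C₉) (h0 : ∀ n, 1 ≤ n → Λ n 0 ≤ C₉ * ω ^ n) (hω0 : 0 ≤ ω)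

/-- Fading memory of ALL the history moduli (`FadingMemory C₉ ω Λ`) gives `0 ≤ C₉` and the fading of the FIRST-entry modulus `Λ n 0 ≤ C₉ω^n` — all the keying question reads. [folklore] -/
theorem firstEntryFading_of_fadingMemory {C₉ ω : ℝ} {Λ : ℕ → ℕ → ℝ} (hΛ : FadingMemory C₉ ω Λ) :
    0 ≤ C₉ ∧ ∀ n, 1 ≤ n → Λ n 0 ≤ C₉ * ω ^ n := by
  refine ⟨fadingMemory_const_nonneg hΛ, fun n _ => ?_⟩
  have h := (hΛ n 0 (Nat.zero_le _)).2
  rwa [Nat.sub_zero] at h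

include hC₉ h0 in
/-- **THE HISTORY SUM OF TWO PREPENDED SEQUENCES reads the first-entry modulus only**: `b ∷ g` and `b′ ∷ g` differ only at index `0`, so
`Σ_{i<n} Λ n i |(b ∷ g)_i − (b′ ∷ g)_i| ≤ C₉ω^n|b − b′|` as soon as `Λ n 0 ≤ C₉ω^n` (`n ≥ 1`) and `0 ≤ C₉` (g2's `historySum_prepend_le` under full fading memory). [folklore] -/
theorem historySum_prepend_le_of_firstEntry (b b' : ℝ) (g : ℕ → ℝ) (n : ℕ) :
    ∑ i ∈ Finset.range n, Λ n i * |prependCoupling b g i - prependCoupling b' g i| ≤ C₉ * ω ^ n * |b - b'| := by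
  cases n with
  | zero =>
    simp only [Finset.range_zero, Finset.sum_empty, pow_zero, mul_one]
    exact mul_nonneg hC₉ (abs_nonneg _)
  | succ n =>
    rw [Finset.sum_range_succ']
    have hz : ∑ i ∈ Finset.range n,
        Λ (n + 1) (i + 1) * |prependCoupling b g (i + 1) - prependCoupling b' g (i + 1)| = 0 := by
      refine Finset.sum_eq_zero fun i _ => ?_
      simp [prependCoupling_succ]
    rw [hz, zero_add, prependCoupling_zero, prependCoupling_zero]
    exact mul_le_mul_of_nonneg_right (h0 (n + 1) (Nat.succ_pos n)) (abs_nonneg _)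

include hsc hd hlink hW h9 hC₉ h0 hω0 in
/-- **THE SPREAD OF A PREPENDED FAMILY UNDER NE9 WITH A FADING FIRST-ENTRY MODULUS** (g2's `eb_sub_eb_le_of_ne9_prepend`, weaker hypothesis): level map `sh` not lowering the scale and
keeping the tree length, background map `τ`, THE LINK `EB b g U X = EA′ (b ∷ g) (τ U) (sh X)`, prepending maps `W` into `W′`; NE9 for `EA′` on `W′` with a fading FIRST-entry column
(`Λ n 0 ≤ C₉ω^n`, `0 ≤ ω ≤ 1`) ⟹ `|EB b g U X − EB b′ g U X| ≤ C₉·ω^{scale X}·|b − b′|·e^{−κ d X}`. [cite: Balaban1987RG1, §5 p.298 (hypothesis shape)] -/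
theorem eb_sub_eb_le_of_ne9_prepend_firstEntry (hω1 : ω ≤ 1) {b b' : ℝ} (hb : 0 < b) (hbγ : b ≤ γ) (hb' : 0 < b') (hb'γ : b' ≤ γ)
    {g : ℕ → ℝ} (hg : g ∈ W) (U : C.BgB) (X : C.Dom) :
    |EB b g U X - EB b' g U X| ≤ C₉ * ω ^ C.scale X * |b - b'| * Real.exp (-(κ * C.d X)) := by
  rw [hlink, hlink]
  have h := h9 _ (hW b hb hbγ g hg) _ (hW b' hb' hb'γ g hg) (τ U) (sh X)
  rw [hd] at h
  have hsum := historySum_prepend_le_of_firstEntry hC₉ h0 b b' g (C'.scale (sh X))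
  have hpow : ω ^ C'.scale (sh X) ≤ ω ^ C.scale X := pow_le_pow_of_le_one hω0 hω1 (hsc X)
  have he := (Real.exp_pos (-(κ * C.d X))).le
  calc |EA' (prependCoupling b g) (τ U) (sh X) - EA' (prependCoupling b' g) (τ U) (sh X)|
      ≤ Real.exp (-(κ * C.d X)) *
          ∑ i ∈ Finset.range (C'.scale (sh X)), Λ (C'.scale (sh X)) i * |prependCoupling b g i - prependCoupling b' g i| := h
    _ ≤ Real.exp (-(κ * C.d X)) * (C₉ * ω ^ C'.scale (sh X) * |b - b'|) := mul_le_mul_of_nonneg_left hsum he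
    _ ≤ Real.exp (-(κ * C.d X)) * (C₉ * ω ^ C.scale X * |b - b'|) :=
        mul_le_mul_of_nonneg_left (mul_le_mul_of_nonneg_right (mul_le_mul_of_nonneg_left hpow hC₉) (abs_nonneg _)) he
    _ = C₉ * ω ^ C.scale X * |b - b'| * Real.exp (-(κ * C.d X)) := by ring

include hsc hd hlink hW h9 hC₉ h0 hω0 in
/-- ★★ **THE FAMILY FROM SOME MEMBER PER POINT.**  In the setting of `eb_sub_eb_le_of_ne9_prepend_firstEntry` (`ω ≤ θ ≤ 1`): if at EVERY point `(g, U, X)` SOME member `b₀ ∈ ]0,γ]`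
of run B's family is `C₅θ^{scale X}e^{−κ d X}`-close to run A (no uniformity of the choice asked), then EVERY member `b ∈ ]0,γ]` is `(C₅ + C₉γ)θ^{scale X}e^{−κ d X}`-close: the box
letter for all `b` — one triangle inequality through `b₀` + the spread bound; the keying in the first coupling is immaterial mod the fading first-entry modulus.
[cite: Balaban1987RG1, Thm 1 p.259 and §5 p.298] -/
theorem ne5_family_of_pointwise (hωθ : ω ≤ θ) (hθ1 : θ ≤ 1)
    (h5 : ∀ g ∈ W, ∀ (U : C.BgB) (X : C.Dom), ∃ b₀ : ℝ, 0 < b₀ ∧ b₀ ≤ γ ∧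
      |EA g (C.transport U) X - EB b₀ g U X| ≤ C₅ * θ ^ C.scale X * Real.exp (-(κ * C.d X))) :
    ∀ b : ℝ, 0 < b → b ≤ γ → NE5 EA (EB b) W κ θ (C₅ + C₉ * γ) := by
  intro b hb hbγ g hg U X
  obtain ⟨b₀, hb₀, hb₀γ, h1⟩ := h5 g hg U X
  have h2 := eb_sub_eb_le_of_ne9_prepend_firstEntry EA' EB sh τ hsc hd hlink hW h9 hC₉ h0 hω0 (hωθ.trans hθ1) hb₀ hb₀γ hb hbγ hg U X
  have hbb : |b₀ - b| ≤ γ := by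
    rw [abs_sub_le_iff]
    constructor <;> linarith
  have hpow : ω ^ C.scale X ≤ θ ^ C.scale X := pow_le_pow_left₀ hω0 hωθ _
  have hθpow : 0 ≤ θ ^ C.scale X := pow_nonneg (hω0.trans hωθ) _
  have he := (Real.exp_pos (-(κ * C.d X))).le
  calc |EA g (C.transport U) X - EB b g U X|
      ≤ |EA g (C.transport U) X - EB b₀ g U X| + |EB b₀ g U X - EB b g U X| := abs_sub_le _ _ _
    _ ≤ C₅ * θ ^ C.scale X * Real.exp (-(κ * C.d X)) +
          C₉ * ω ^ C.scale X * |b₀ - b| * Real.exp (-(κ * C.d X)) := add_le_add h1 h2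
    _ ≤ C₅ * θ ^ C.scale X * Real.exp (-(κ * C.d X)) + C₉ * θ ^ C.scale X * γ * Real.exp (-(κ * C.d X)) :=
        add_le_add le_rfl (mul_le_mul_of_nonneg_right
          (mul_le_mul (mul_le_mul_of_nonneg_left hpow hC₉) hbb (abs_nonneg _) (mul_nonneg hC₉ hθpow)) he)
    _ = (C₅ + C₉ * γ) * θ ^ C.scale X * Real.exp (-(κ * C.d X)) := by ring

include hsc hd hlink hW h9 hC₉ h0 hω0 in
/-- ★ **THE FAMILY FROM A SELECTOR-KEYED MEMBER** — the N19′ rate edge's `h18` SHAPE `NE5 EA (fun g ↦ EB (bsel g) g) W κ θ C₅` at ANY selector `bsel` admissible on `W`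
(`bsel g ∈ ]0,γ]`) gives the box letter at every member with `C₅ + C₉γ`. [cite: Balaban1987RG1, Thm 1 p.259 and §5 p.298] -/
theorem ne5_family_of_selector (hωθ : ω ≤ θ) (hθ1 : θ ≤ 1) {bsel : (ℕ → ℝ) → ℝ} (hbsel : ∀ g ∈ W, 0 < bsel g ∧ bsel g ≤ γ) (h5 : NE5 EA (fun g => EB (bsel g) g) W κ θ C₅) :
    ∀ b : ℝ, 0 < b → b ≤ γ → NE5 EA (EB b) W κ θ (C₅ + C₉ * γ) :=
  ne5_family_of_pointwise EA EA' EB sh τ hsc hd hlink hW h9 hC₉ h0 hω0 hωθ hθ1 fun g hg U X =>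
    ⟨bsel g, (hbsel g hg).1, (hbsel g hg).2, h5 g hg U X⟩

include hsc hd hlink hW h9 hC₉ h0 hω0 in
/-- **TWO SELECTORS**: the `h18` shape at one admissible selector gives it at any other, constant `C₅ + C₉γ` — modulo node N22 the N19′ link reading's choice of `bsel` is immaterial
as far as the RATE goes (the «first-coupling recovery» g7 proves identifies run B's TERM, not the rate). [cite: Balaban1987RG1, Thm 1 p.259 and §5 p.298] -/
theorem ne5_selector_of_selector (hωθ : ω ≤ θ) (hθ1 : θ ≤ 1) {bsel : (ℕ → ℝ) → ℝ} (hbsel : ∀ g ∈ W, 0 < bsel g ∧ bsel g ≤ γ)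
    (h5 : NE5 EA (fun g => EB (bsel g) g) W κ θ C₅) {bsel' : (ℕ → ℝ) → ℝ} (hbsel' : ∀ g ∈ W, 0 < bsel' g ∧ bsel' g ≤ γ) :
    NE5 EA (fun g => EB (bsel' g) g) W κ θ (C₅ + C₉ * γ) := fun g hg U X =>
  ne5_family_of_selector EA EA' EB sh τ hsc hd hlink hW h9 hC₉ h0 hω0 hωθ hθ1 hbsel h5 (bsel' g) (hbsel' g hg).1 (hbsel' g hg).2 g hg U X

include hsc hd hlink hW h9 hC₉ h0 hω0 in
/-- ★ **THE FAMILY FROM THE STEP-MATCHED LETTER** — g7's R-N18-SEL letter (NE5 asked only at the pairs `(b, s)` on the graph of the first (0.20) step `1∕b² = 1∕(s 0)² + β₁(b)`)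
plus predecessor EXISTENCE in `]0,γ]` for every history of `W` gives the box letter at every member with `C₅ + C₉γ`. [cite: Balaban1987RG1, (0.20) p.256, Thm 1 p.259 and §5 p.298] -/
theorem ne5_family_of_stepMatched (hωθ : ω ≤ θ) (hθ1 : θ ≤ 1) {β : HBeta}
    (hSM : ∀ b, 0 < b → b ≤ γ → ∀ s ∈ W, 1 / b ^ 2 = 1 / (s 0) ^ 2 + β 0 (fun _ => b) →
      ∀ (U : C.BgB) (X : C.Dom), |EA s (C.transport U) X - EB b s U X| ≤ C₅ * θ ^ C.scale X * Real.exp (-(κ * C.d X)))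
    (hpred : ∀ s ∈ W, ∃ b, 0 < b ∧ b ≤ γ ∧ 1 / b ^ 2 = 1 / (s 0) ^ 2 + β 0 (fun _ => b)) :
    ∀ b : ℝ, 0 < b → b ≤ γ → NE5 EA (EB b) W κ θ (C₅ + C₉ * γ) :=
  ne5_family_of_pointwise EA EA' EB sh τ hsc hd hlink hW h9 hC₉ h0 hω0 hωθ hθ1 fun s hs U X => by
    obtain ⟨b, hb, hbγ, hm⟩ := hpred s hs
    exact ⟨b, hb, hbγ, hSM b hb hbγ s hs hm U X⟩

end Generic

/-! ## §2 def-W1's kernel objects (any `ℰ`): the box LIMIT letter from SOME member per point ∕ a selector ∕ the step-matched letter (limit or FINITE-VOLUME row), mod NE9 (limit or WINDOWED) -/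

section Kernels

open scoped Matrix.Norms.L2Operator

variable {𝔄 : Type*} [NormedRing 𝔄] [NormedAlgebra ℝ 𝔄]
variable {V : Type*} [NormedAddCommGroup V] [NormedSpace ℝ V] {ι : Type*} [Fintype ι]
variable (F : T4Family) (ℰ : TermFamily1 F 𝔄) (ρ : V →L[ℝ] 𝔄) (bV : Module.Basis ι ℝ V)
variable {γ κ C₉ ω θ C₅ : ℝ} {Λ : ℕ → ℕ → ℝ} {β : HBeta}
  (h9 : NE9 (EA F ℰ ρ bV) (Window γ) κ Λ) (hlim : PolLimitsExist F ℰ ρ bV (Window γ)) (hK : WindowedNE9 F ℰ ρ bV (Window γ) κ Λ)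
  (hΛ : FadingMemory C₉ ω Λ) (hω0 : 0 ≤ ω) (hωθ : ω ≤ θ) (hθ1 : θ ≤ 1)

include h9 hΛ hω0 hωθ hθ1 in
/-- **THE FAMILY FROM SOME MEMBER PER POINT AT THE KERNEL OBJECTS** (NE5 currency; §1 with the level shift `(k,μ,ν,z) ↦ (k+1,μ,ν,z)`, g2's `EB_eq_EA_prepend_shift`): NE9 for run A's
kernel functional on `]0,γ]^ℕ` (`U3OfKernels.ne9_EA_iff` for the kernel form) with moduli of fading memory `(C₉, ω)`, `0 ≤ ω ≤ θ ≤ 1`, and NE5 at SOME member per point ⟹ NE5 at EVERY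
member, constant `C₅ + C₉γ`. [cite: Balaban1987RG1, Thm 1 p.259 and §5 p.298] -/
theorem ne5_objects_family_of_pointwise
    (h5 : ∀ g ∈ Window γ, ∀ (U : carriers.BgB) (X : carriers.Dom), ∃ b₀ : ℝ, 0 < b₀ ∧ b₀ ≤ γ ∧
      |EA F ℰ ρ bV g (carriers.transport U) X - EB F ℰ ρ bV b₀ g U X| ≤ C₅ * θ ^ carriers.scale X * Real.exp (-(κ * carriers.d X))) :
    ∀ b : ℝ, 0 < b → b ≤ γ → NE5 (EA F ℰ ρ bV) (EB F ℰ ρ bV b) (Window γ) κ θ (C₅ + C₉ * γ) :=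
  ne5_family_of_pointwise (C := carriers) (C' := carriers) (EA F ℰ ρ bV) (EA F ℰ ρ bV) (EB F ℰ ρ bV) (fun p => (p.1 + 1, p.2)) id
    (fun _ => Nat.le_succ _) (fun _ => rfl) (EB_eq_EA_prepend_shift F ℰ ρ bV) (fun _ hb hbγ _ hg => prependCoupling_mem_window hb hbγ hg) h9
    (firstEntryFading_of_fadingMemory hΛ).1 (firstEntryFading_of_fadingMemory hΛ).2 hω0 hωθ hθ1 h5

include h9 hΛ hω0 hωθ hθ1 in
/-- **THE FAMILY FROM A SELECTOR AT THE KERNEL OBJECTS** (the N19′ `h18` shape at def-W1's functionals, any admissible `bsel`). [cite: Balaban1987RG1, Thm 1 p.259 and §5 p.298] -/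
theorem ne5_objects_family_of_selector {bsel : (ℕ → ℝ) → ℝ} (hbsel : ∀ g ∈ Window γ, 0 < bsel g ∧ bsel g ≤ γ) (h5 : NE5 (EA F ℰ ρ bV) (fun g => EB F ℰ ρ bV (bsel g) g) (Window γ) κ θ C₅) :
    ∀ b : ℝ, 0 < b → b ≤ γ → NE5 (EA F ℰ ρ bV) (EB F ℰ ρ bV b) (Window γ) κ θ (C₅ + C₉ * γ) :=
  ne5_objects_family_of_pointwise F ℰ ρ bV h9 hΛ hω0 hωθ hθ1 fun g hg U X => ⟨bsel g, (hbsel g hg).1, (hbsel g hg).2, h5 g hg U X⟩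

include h9 hΛ hω0 hωθ hθ1 in
/-- ★★ **THE BOX LETTER FROM SOME MEMBER PER POINT, KERNEL CURRENCY**: node N22's NE9 (with fading moduli) for run A's kernel functional and, at every `(g, k, μ, ν, z)`, SOME
`b₀ ∈ ]0,γ]` with `|Π_{k+1}(g; z) − Π_{k+2}(b₀, g; z)| ≤ C₅θ^{k+1}e^{−κ|z|₁}` ⟹ W1-19b's `KernelStepRate F ℰ ρ bV γ κ θ (C₅ + C₉γ)`.
[cite: Balaban1987RG1, Thm 1 p.259, (1.21) p.264 and §5 p.298] -/
theorem kernelStepRate_of_pointwise_of_ne9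
    (h5 : ∀ g ∈ Window γ, ∀ (k : ℕ) (μ ν : Fin 4) (z : Fin 4 → ℤ), ∃ b₀ : ℝ, 0 < b₀ ∧ b₀ ≤ γ ∧
      |kernelA F ℰ ρ bV g k μ ν z - kernelA F ℰ ρ bV (prependCoupling b₀ g) (k + 1) μ ν z| ≤ C₅ * θ ^ (k + 1) * Real.exp (-(κ * l1 z))) :
    KernelStepRate F ℰ ρ bV γ κ θ (C₅ + C₉ * γ) :=
  (kernelStepRate_iff F ℰ ρ bV γ κ θ _).2 fun b hb hbγ =>
    (ne5_iff F ℰ ρ bV b (Window γ) κ θ _).1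
      (ne5_objects_family_of_pointwise F ℰ ρ bV h9 hΛ hω0 hωθ hθ1
        (by
          rintro g hg U ⟨k, μ, ν, z⟩
          exact h5 g hg k μ ν z)
        b hb hbγ)

include h9 hΛ hω0 hωθ hθ1 in
/-- ★★ **THE BOX LETTER FROM THE KERNEL STEP-MATCHED LETTER** (g7 FILE 2 §4's text: N18's η-rate asked ONLY at the pairs `(b; g)` with `1∕b² = 1∕(g 0)² + β₁(b)`) + predecessor
existence in `]0,γ]` + node N22's NE9 ⟹ W1-19b∕W1-21's BOX letter `KernelStepRate F ℰ ρ bV γ κ θ (C₅ + C₉γ)`. [cite: Balaban1987RG1, (0.20) p.256, Thm 1 p.259 and §5 p.298] -/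
theorem kernelStepRate_of_kernelStepMatched_of_ne9
    (hSM : ∀ b, 0 < b → b ≤ γ → ∀ g ∈ Window γ, 1 / b ^ 2 = 1 / (g 0) ^ 2 + β 0 (fun _ => b) → ∀ (k : ℕ) (μ ν : Fin 4) (z : Fin 4 → ℤ),
      |kernelA F ℰ ρ bV g k μ ν z - kernelA F ℰ ρ bV (prependCoupling b g) (k + 1) μ ν z| ≤ C₅ * θ ^ (k + 1) * Real.exp (-(κ * l1 z)))
    (hpred : ∀ g ∈ Window γ, ∃ b, 0 < b ∧ b ≤ γ ∧ 1 / b ^ 2 = 1 / (g 0) ^ 2 + β 0 (fun _ => b)) :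
    KernelStepRate F ℰ ρ bV γ κ θ (C₅ + C₉ * γ) :=
  kernelStepRate_of_pointwise_of_ne9 F ℰ ρ bV h9 hΛ hω0 hωθ hθ1 fun g hg k μ ν z => by
    obtain ⟨b, hb, hbγ, hm⟩ := hpred g hg
    exact ⟨b, hb, hbγ, hSM b hb hbγ g hg hm k μ ν z⟩

include h9 hΛ hω0 hωθ hθ1 in
/-- ★ **BOX ⟺ STEP-MATCHED MODULO N22** (existential constants): under node N22's NE9 with fading moduli (`ω ≤ θ ≤ 1`) and predecessor existence, SOME constant makes the box letter
hold iff SOME constant makes the step-matched letter hold (`C₅ ↦ C₅` by g7's `kernelStepMatched_of_kernelStepRate`; `C₅ ↦ C₅ + C₉γ` back) — re-keying K3's N18 conjunct to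
R-N18-SEL changes nothing for a holder of N22. [cite: Balaban1987RG1, (0.20) p.256, Thm 1 p.259 and §5 p.298] -/
theorem exists_kernelStepRate_iff_exists_kernelStepMatched
    (hpred : ∀ g ∈ Window γ, ∃ b, 0 < b ∧ b ≤ γ ∧ 1 / b ^ 2 = 1 / (g 0) ^ 2 + β 0 (fun _ => b)) :
    (∃ C₅ : ℝ, KernelStepRate F ℰ ρ bV γ κ θ C₅) ↔
      ∃ C₅ : ℝ, ∀ b, 0 < b → b ≤ γ → ∀ g ∈ Window γ, 1 / b ^ 2 = 1 / (g 0) ^ 2 + β 0 (fun _ => b) → ∀ (k : ℕ) (μ ν : Fin 4) (z : Fin 4 → ℤ),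
        |kernelA F ℰ ρ bV g k μ ν z - kernelA F ℰ ρ bV (prependCoupling b g) (k + 1) μ ν z| ≤ C₅ * θ ^ (k + 1) * Real.exp (-(κ * l1 z)) :=
  ⟨fun ⟨C₅, h⟩ => ⟨C₅, kernelStepMatched_of_kernelStepRate F ℰ ρ bV h β⟩,
    fun ⟨_, h⟩ => ⟨_, kernelStepRate_of_kernelStepMatched_of_ne9 F ℰ ρ bV h9 hΛ hω0 hωθ hθ1 h hpred⟩⟩

/-- **PREDECESSORS EXIST ON THE WINDOW from the level-0 β-side binders** (continuity, sign `0 ≤ β₁`, bound `β₁ ≤ β′` on `]0,γ]` — DISPLAYED; g7 §1 `exists_pred_of_sign_upper_cont`,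
intermediate value theorem): the `hpred` row of this file. [cite: Balaban1987RG1, (0.20) p.256 and §1 pp.263–264] -/
theorem pred_exists_on_window_of_levelZero {β' : ℝ} (hcont : ContinuousOn (fun b : ℝ => β 0 (fun _ => b)) (Set.Ioc 0 γ))
    (hsign : ∀ b, 0 < b → b ≤ γ → 0 ≤ β 0 (fun _ => b)) (hup : ∀ b, 0 < b → b ≤ γ → β 0 (fun _ => b) ≤ β') :
    ∀ g ∈ Window γ, ∃ b, 0 < b ∧ b ≤ γ ∧ 1 / b ^ 2 = 1 / (g 0) ^ 2 + β 0 (fun _ => b) := fun g hg => by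
  obtain ⟨b, hb, hbx, hm⟩ := exists_pred_of_sign_upper_cont hcont hsign hup (mem_window.mp hg 0).1 (mem_window.mp hg 0).2
  exact ⟨b, hb, hbx.trans (mem_window.mp hg 0).2, hm⟩

include hlim hK hΛ hω0 hωθ hθ1 in
/-- ★ **THE BOX LIMIT LETTER FROM THE KERNEL STEP-MATCHED LETTER AND NODE N22's WINDOWED ROWS**: (1.21)-existence on the window (`PolLimitsExist`, the bill's `hL` shape) + W1-19b's
`WindowedNE9 … κ Λ` (the bill's `h9` shape) give NE9 on the limiting kernels (dag-n22-w3's `ne9_EA_of_windowed`); then `kernelStepRate_of_kernelStepMatched_of_ne9`.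
[cite: Balaban1987RG1, (1.18) p.263, (1.21) p.264, Thm 1 p.259 and §5 p.298] -/
theorem kernelStepRate_of_kernelStepMatched_of_windowedNE9
    (hSM : ∀ b, 0 < b → b ≤ γ → ∀ g ∈ Window γ, 1 / b ^ 2 = 1 / (g 0) ^ 2 + β 0 (fun _ => b) → ∀ (k : ℕ) (μ ν : Fin 4) (z : Fin 4 → ℤ),
      |kernelA F ℰ ρ bV g k μ ν z - kernelA F ℰ ρ bV (prependCoupling b g) (k + 1) μ ν z| ≤ C₅ * θ ^ (k + 1) * Real.exp (-(κ * l1 z)))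
    (hpred : ∀ g ∈ Window γ, ∃ b, 0 < b ∧ b ≤ γ ∧ 1 / b ^ 2 = 1 / (g 0) ^ 2 + β 0 (fun _ => b)) :
    KernelStepRate F ℰ ρ bV γ κ θ (C₅ + C₉ * γ) :=
  kernelStepRate_of_kernelStepMatched_of_ne9 F ℰ ρ bV (ne9_EA_of_windowed F ℰ ρ bV hlim hK) hΛ hω0 hωθ hθ1 hSM hpred

include hlim hK hΛ hω0 hωθ hθ1 in
/-- ★★ **THE BOX LIMIT LETTER FROM THE FINITE-VOLUME STEP-MATCHED ROW AND NODE N22's WINDOWED ROWS**: g7 FILE 4 §9's WINDOWED STEP-MATCHED RATE (W1-19b's `WindowedStepRate … s κ θ (C₅θ)`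
asked ONLY at the box histories `w` with `1∕(w 0)² = 1∕(w 1)² + β₁(w 0)`) + `PolLimitsExist` + `WindowedNE9` + fading + predecessor existence ⟹ `KernelStepRate F ℰ ρ bV γ κ θ (C₅ + C₉γ)` — the
re-keyed finite-volume row produces the SAME box limit letter the current bill's rows `hL ∧ hS` produce (g2 `kernelStepRate_of_windowed`), once `h9` is on the table.
[cite: Balaban1987RG1, (0.20) p.256, (1.18) p.263, (1.20)–(1.21) p.264, Thm 1 p.259 and §5 p.298] -/
theorem kernelStepRate_of_windowedStepMatched_of_windowedNE9 (s : ℕ)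
    (hfin : ∀ (k : ℕ) (w : Fin (k + 2) → ℝ), w ∈ Box γ (k + 1) → 1 / (w 0) ^ 2 = 1 / (Fin.tail w 0) ^ 2 + β 0 (fun _ => w 0) →
      ∀ (μ ν : Fin 4) (x : Fin 4 → ℤ), ∀ᶠ K in Filter.atTop,
        |Node00.polWindow F (K + s) (k + 1 + 1) (ℰ (k + 1) w (K + s)) ρ bV μ ν x - Node00.polWindow F K (k + 1) (ℰ k (Fin.tail w) K) ρ bV μ ν x| ≤
          C₅ * θ * θ ^ k * Real.exp (-κ * l1 x))
    (hpred : ∀ g ∈ Window γ, ∃ b, 0 < b ∧ b ≤ γ ∧ 1 / b ^ 2 = 1 / (g 0) ^ 2 + β 0 (fun _ => b)) :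
    KernelStepRate F ℰ ρ bV γ κ θ (C₅ + C₉ * γ) :=
  kernelStepRate_of_kernelStepMatched_of_windowedNE9 F ℰ ρ bV hlim hK hΛ hω0 hωθ hθ1
    (kernelStepMatched_of_windowedStepMatched F ℰ ρ bV (β := β) s
      (YMDAG.N18.KernelStepRateBoxes.polLimitExists_box_of_window F ℰ ρ bV hlim) hfin) hpred

variable {N : ℕ} [NeZero N]

/-- **N18 AT THE ₁₃ BUNDLE OF THE KERNEL OBJECTS FROM N22 AND A SELECTOR** (g2's `…_of_n22At_of_member` with the constant member replaced by ANY admissible selector): `N22At` at the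
bundle (any run-length index `k′`), `ℓ.Signs`, `ℓ.ω ≤ ℓ.θ₅`, and the N19′ `h18` SHAPE `NE5 EA (fun s ↦ EB (bsel s) s) ]0,θ.γ]^ℕ ℓ.κ ℓ.θ₅ (ℓ.C₅ − ℓ.C₉·θ.γ)` ⟹ `N18At` at the bundle
(every index `k`). [cite: Balaban1987RG1, Thm 1 p.259 and §5 p.298] -/
theorem n18At_u3OfRecord₁₃_objects_of_n22At_of_selector (θ : Stage13Params F N) (ℓ : U3Letters₁₁) (hs : ℓ.Signs) (hωθ : ℓ.ω ≤ ℓ.θ₅) (k k' : ℕ)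
    (h22 : N22At (u3OfRecord₁₃ θ (objects F ℰ ρ bV ℓ) k')) {bsel : (ℕ → ℝ) → ℝ} (hbsel : ∀ g ∈ Window θ.γ, 0 < bsel g ∧ bsel g ≤ θ.γ)
    (h5 : NE5 (EA F ℰ ρ bV) (fun s => EB F ℰ ρ bV (bsel s) s) (Window θ.γ) ℓ.κ ℓ.θ₅ (ℓ.C₅ - ℓ.C₉ * θ.γ)) :
    N18At (u3OfRecord₁₃ θ (objects F ℰ ρ bV ℓ) k) := by
  have h9 : NE9 (EA F ℰ ρ bV) (Window θ.γ) ℓ.κ ℓ.moduli := h22.1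
  have hΛ : FadingMemory ℓ.C₉ ℓ.ω ℓ.moduli := h22.2
  have h := ne5_objects_family_of_selector F ℰ ρ bV h9 hΛ hs.ω_nonneg hωθ hs.θ₅_lt_one.le hbsel h5
  rw [sub_add_cancel] at h
  exact h

/-- **N18 AT THE ₁₃ BUNDLE OF THE KERNEL OBJECTS FROM N22 AND THE KERNEL STEP-MATCHED LETTER** (constant `ℓ.C₅ − ℓ.C₉·θ.γ`, any law `β` with predecessors in `]0,θ.γ]`).
[cite: Balaban1987RG1, (0.20) p.256, Thm 1 p.259 and §5 p.298] -/
theorem n18At_u3OfRecord₁₃_objects_of_n22At_of_stepMatched (θ : Stage13Params F N) (ℓ : U3Letters₁₁) (hs : ℓ.Signs) (hωθ : ℓ.ω ≤ ℓ.θ₅) (k k' : ℕ)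
    (h22 : N22At (u3OfRecord₁₃ θ (objects F ℰ ρ bV ℓ) k'))
    (hSM : ∀ b, 0 < b → b ≤ θ.γ → ∀ g ∈ Window θ.γ, 1 / b ^ 2 = 1 / (g 0) ^ 2 + β 0 (fun _ => b) → ∀ (j : ℕ) (μ ν : Fin 4) (z : Fin 4 → ℤ),
      |kernelA F ℰ ρ bV g j μ ν z - kernelA F ℰ ρ bV (prependCoupling b g) (j + 1) μ ν z| ≤ (ℓ.C₅ - ℓ.C₉ * θ.γ) * ℓ.θ₅ ^ (j + 1) * Real.exp (-(ℓ.κ * l1 z)))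
    (hpred : ∀ g ∈ Window θ.γ, ∃ b, 0 < b ∧ b ≤ θ.γ ∧ 1 / b ^ 2 = 1 / (g 0) ^ 2 + β 0 (fun _ => b)) :
    N18At (u3OfRecord₁₃ θ (objects F ℰ ρ bV ℓ) k) := by
  have h9 : NE9 (EA F ℰ ρ bV) (Window θ.γ) ℓ.κ ℓ.moduli := h22.1
  have hΛ : FadingMemory ℓ.C₉ ℓ.ω ℓ.moduli := h22.2
  have h := kernelStepRate_of_kernelStepMatched_of_ne9 F ℰ ρ bV h9 hΛ hs.ω_nonneg hωθ hs.θ₅_lt_one.le hSM hpred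
  rw [sub_add_cancel] at h
  exact (n18At_u3OfRecord₁₃_objects_iff_kernelStepRate F ℰ ρ bV θ ℓ k).2 h

end Kernels

/-! ## §3 At the record (Stage 13, letters OF RECORD) and under the reading pin -/

section Record

open scoped Matrix.Norms.L2Operator

variable (F : T4Family) (N : ℕ) [NeZero N] (θ : Stage13Params F N) (ℓ : U3Letters₁₁) (hs : ℓ.Signs) (hωθ : ℓ.ω ≤ ℓ.θ₅)
  (hlim : PolLimitsExistOfRecord₁₃ F N θ) (hK : WindowedNE9OfRecord₁₃ F N θ ℓ.κ ℓ.moduli) (β : HBeta)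

include hs hωθ hlim hK in
/-- ★★ **THE N18 LETTER OF RECORD FROM THE STEP-MATCHED LETTER AND THE BILL's ROWS `hL ∧ h9`**: `PolLimitsExistOfRecord₁₃ F N θ`, `WindowedNE9OfRecord₁₃ F N θ ℓ.κ ℓ.moduli` (node N22's
row of record — moduli `ℓ.C₉·ℓ.ω^(a−i)`), `ℓ.Signs`, `ℓ.ω ≤ ℓ.θ₅`, the kernel step-matched letter for the merged term of record (run A's functional of record `(objectsOfRecord₁₃ …).EA 0`,
any law `β`, constant `ℓ.C₅ − ℓ.C₉·θ.γ`) and predecessor existence ⟹ the BOX letter of record `KernelStepRateOfRecord₁₃ F N θ ℓ.κ ℓ.θ₅ ℓ.C₅` (n27-c's ∕ dag-n18-w4 FILE 6's limit-bill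
row `h18`). [cite: Balaban1987RG1, (0.20) p.256, Thm 1 p.259, (1.21) p.264, (1.6) p.261 and §5 p.298] -/
theorem kernelStepRateOfRecord₁₃_of_stepMatched_of_windowedNE9OfRecord₁₃
    (hSM : ∀ b, 0 < b → b ≤ θ.γ → ∀ g ∈ Window θ.γ, 1 / b ^ 2 = 1 / (g 0) ^ 2 + β 0 (fun _ => b) → ∀ (k : ℕ) (μ ν : Fin 4) (z : Fin 4 → ℤ),
      |(objectsOfRecord₁₃ F N θ ℓ).EA 0 g PUnit.unit (pt k μ ν z) - (objectsOfRecord₁₃ F N θ ℓ).EA 0 (prependCoupling b g) PUnit.unit (pt (k + 1) μ ν z)| ≤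
        (ℓ.C₅ - ℓ.C₉ * θ.γ) * ℓ.θ₅ ^ (k + 1) * Real.exp (-(ℓ.κ * l1 z)))
    (hpred : ∀ g ∈ Window θ.γ, ∃ b, 0 < b ∧ b ≤ θ.γ ∧ 1 / b ^ 2 = 1 / (g 0) ^ 2 + β 0 (fun _ => b)) :
    KernelStepRateOfRecord₁₃ F N θ ℓ.κ ℓ.θ₅ ℓ.C₅ := by
  letI := θ.instVβ₁; letI := θ.instVβ₂; letI := θ.instιβ
  have h := kernelStepRate_of_kernelStepMatched_of_windowedNE9 F _ θ.ρ8 θ.bV (β := β) hlim hK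
    (fun a i _ => ⟨hs.moduli_nonneg a i, le_rfl⟩) hs.ω_nonneg hωθ hs.θ₅_lt_one.le
    (fun b hb hbγ g hg hm k μ ν z => hSM b hb hbγ g hg hm k μ ν z) hpred
  rw [sub_add_cancel] at h
  exact h

include hs hωθ hlim hK in
/-- ★★ **THE N18 LETTER OF RECORD FROM THE FINITE-VOLUME STEP-MATCHED ROW OF RECORD AND THE BILL's ROWS `hL ∧ h9`**: the same with g7 FILE 4 §10's WINDOWED STEP-MATCHED RATE OF RECORD
(the two runs' (2.13)-terms on the same tori at the step-matched box histories of `β`, `K`-eventually, constant `(ℓ.C₅ − ℓ.C₉·θ.γ)·ℓ.θ₅`) — a K3 bill with its N18 row so re-keyed proves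
EXACTLY what the present bill proves from `hL ∧ h9 ∧ hS`. [cite: Balaban1987RG1, (0.20) p.256, Thm 1 p.259, (1.20)–(1.21) p.264, (1.6) p.261 and §5 p.298] -/
theorem kernelStepRateOfRecord₁₃_of_windowedStepMatchedOfRecord_of_windowedNE9OfRecord₁₃ (s : ℕ)
    (hfin : letI := θ.instVβ₁; letI := θ.instVβ₂; letI := θ.instιβ
      ∀ (k : ℕ) (w : Fin (k + 2) → ℝ), w ∈ Box θ.γ (k + 1) → 1 / (w 0) ^ 2 = 1 / (Fin.tail w 0) ^ 2 + β 0 (fun _ => w 0) →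
        ∀ (μ ν : Fin 4) (x : Fin 4 → ℤ), ∀ᶠ K in Filter.atTop,
        |Node00.polWindow F (K + s) (k + 1 + 1)
            (Node00.mergedTermFamilyMatT F N (Node00.TβOfRecord₁₃ F N) (Node00.chiβOfRecord₁₃ F N θ) θ.εbg (k + 1) w (K + s)) θ.ρ8 θ.bV μ ν x -
          Node00.polWindow F K (k + 1)
            (Node00.mergedTermFamilyMatT F N (Node00.TβOfRecord₁₃ F N) (Node00.chiβOfRecord₁₃ F N θ) θ.εbg k (Fin.tail w) K) θ.ρ8 θ.bV μ ν x| ≤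
          (ℓ.C₅ - ℓ.C₉ * θ.γ) * ℓ.θ₅ * ℓ.θ₅ ^ k * Real.exp (-ℓ.κ * l1 x))
    (hpred : ∀ g ∈ Window θ.γ, ∃ b, 0 < b ∧ b ≤ θ.γ ∧ 1 / b ^ 2 = 1 / (g 0) ^ 2 + β 0 (fun _ => b)) :
    KernelStepRateOfRecord₁₃ F N θ ℓ.κ ℓ.θ₅ ℓ.C₅ := by
  letI := θ.instVβ₁; letI := θ.instVβ₂; letI := θ.instιβ
  have h := kernelStepRate_of_windowedStepMatched_of_windowedNE9 F _ θ.ρ8 θ.bV (β := β) hlim hK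
    (fun a i _ => ⟨hs.moduli_nonneg a i, le_rfl⟩) hs.ω_nonneg hωθ hs.θ₅_lt_one.le s hfin hpred
  rw [sub_add_cancel] at h
  exact h

include hs hωθ in
/-- **N18 AT THE BUNDLE OF RECORD FROM N22 AND A SELECTOR** (`…_objects_of_n22At_of_selector` at the merged term family of record): `N22At` at the bundle of record (any index), `ℓ.Signs`,
`ℓ.ω ≤ ℓ.θ₅`, the N19′ `h18` shape through ANY admissible selector, constant `ℓ.C₅ − ℓ.C₉·θ.γ` ⟹ `N18At` at the bundle of record (every index). [cite: Balaban1987RG1, Thm 1 p.259 and §5 p.298] -/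
theorem n18At_u3OfRecord₁₃_objectsOfRecord₁₃_of_n22At_of_selector (k k' : ℕ) (h22 : N22At (u3OfRecord₁₃ θ (objectsOfRecord₁₃ F N θ ℓ) k'))
    {bsel : (ℕ → ℝ) → ℝ} (hbsel : ∀ g ∈ Window θ.γ, 0 < bsel g ∧ bsel g ≤ θ.γ)
    (h5 : NE5 ((objectsOfRecord₁₃ F N θ ℓ).EA k) (fun s => (objectsOfRecord₁₃ F N θ ℓ).EB k (bsel s) s) (Window θ.γ) ℓ.κ ℓ.θ₅ (ℓ.C₅ - ℓ.C₉ * θ.γ)) :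
    N18At (u3OfRecord₁₃ θ (objectsOfRecord₁₃ F N θ ℓ) k) := by
  letI := θ.instVβ₁; letI := θ.instVβ₂; letI := θ.instιβ
  have hobj : objectsOfRecord₁₃ F N θ ℓ =
      objects F (Node00.mergedTermFamilyMatT F N (Node00.TβOfRecord₁₃ F N) (Node00.chiβOfRecord₁₃ F N θ) θ.εbg) θ.ρ8 θ.bV ℓ := rfl
  rw [hobj] at h22 h5 ⊢
  exact n18At_u3OfRecord₁₃_objects_of_n22At_of_selector F _ θ.ρ8 θ.bV θ ℓ hs hωθ k k' h22 hbsel h5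

/-- ★ **PIN FORM — WHAT A `stub_expansion13HV` ∕ N19′ PROVER MEETS**: under K3's node-U3 pin, `N22At` at ANY run-length bundle of the reading (the last conjunct of `RatesHolderAt`),
`ℓ.Signs`, `ℓ.ω ≤ ℓ.θ₅`, and the N19′ edge's `h18` SHAPE `NE5 R.u3.EA (fun s ↦ R.u3.EB (bsel s) s) R.u3.W …` at ANY admissible selector (constant `ℓ.C₅ − ℓ.C₉·θ.γ`;
`R.u3 = (rateCarriersOfRecord₁₃CoPH 𝔯 …).u3`, `R.u3.W = ]0,θ.γ]^ℕ`) ⟹ the BOX conjunct `N18At (rateCarriersOfRecord₁₃CoPH 𝔯 F θ hP g₀ os k).u3` at EVERY run length — the selector a link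
reading binds is as good as any other, and as good as the box, modulo the `N22At` it already holds. [cite: Balaban1987RG1, Thm 1 p.259 and §5 p.298] -/
theorem n18At_rateCarriers_of_kernels_pin_of_n22At_of_ne5_selector {N : ℕ} [NeZero N] (𝔯 : RateReading₁₃CoPH N) (θ : Stage13HParams F N)
    (hP : θ.Provisos₁₃CoPH F N) (g₀ : ℕ → ℝ) (os : List (ULoop F)) (ℓ : U3Letters₁₁)
    (hpin : (𝔯.lit F θ hP g₀ os).u3 = objectsOfRecord₁₃ F N θ.toStage13Params ℓ) (hs : ℓ.Signs) (hωθ : ℓ.ω ≤ ℓ.θ₅)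
    (k k' : ℕ) (h22 : N22At (rateCarriersOfRecord₁₃CoPH 𝔯 F θ hP g₀ os k').u3)
    {bsel : (ℕ → ℝ) → ℝ} (hbsel : ∀ g ∈ Window θ.γ, 0 < bsel g ∧ bsel g ≤ θ.γ)
    (h18 : NE5 ((objectsOfRecord₁₃ F N θ.toStage13Params ℓ).EA k) (fun s => (objectsOfRecord₁₃ F N θ.toStage13Params ℓ).EB k (bsel s) s)
      (Window θ.γ) ℓ.κ ℓ.θ₅ (ℓ.C₅ - ℓ.C₉ * θ.γ)) :
    N18At (rateCarriersOfRecord₁₃CoPH 𝔯 F θ hP g₀ os k).u3 := by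
  change N22At (u3OfRecord₁₃ θ.toStage13Params (𝔯.lit F θ hP g₀ os).u3 k') at h22
  show N18At (u3OfRecord₁₃ θ.toStage13Params (𝔯.lit F θ hP g₀ os).u3 k)
  rw [hpin] at h22 ⊢
  exact n18At_u3OfRecord₁₃_objectsOfRecord₁₃_of_n22At_of_selector F N θ.toStage13Params ℓ hs hωθ k k' h22 hbsel h18

end Record

end YMDAG.N18.KeyingsModuloN22

end
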